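import Summits.FinalStateConjecture.FinalStateConjecture.Theses.BartnikGapSettling
import Literature.Geometry.Lorentzian.VisibleIncompleteNullRay

/-!
# Round-2 ideator 5 — crux `GenericCensorshipCollarMargin` (stmt-FinalStateConjecture-10809): Sketch (published as Round2K5Sketch.lean)

No idea card is filed against the FILED text in this round (see `ROUND2-k5.md`).  This file holds the
checkable statements behind the memo:

* §1 `CorePersistence` — the first lemma of the family-design-independent NO-GO: every jointly
  smooth witness family `F` (old OR tame genericity) converges to its base datum pointwise (indeed
  `C^∞` on compacta) as `c → 0`; hence every member `F c`, `c` small, carries the base datum's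
  strong-field core and every whole-MGHD margin clause inherits the core's (uncontrolled) interior.
* §2 `GenericCensorshipCollarMarginT` — the candidate TAME restatement (10809T) that the summit
  re-type of 2026-08-16T21:18Z (`IsChristodoulouGeneric ↦ IsTameChristodoulouGeneric` in
  `FinalStateConjecture`) forces on this crux, with the leads' windows (label `m₀ ≤ M₁ ≤ m₀⁻¹`,
  boost `boostNorm mo₁ ≤ ρ₀`), ORDER FIXED AT 2, H4 (FUTURE) and H5a (VISIBLE); elaborates.
* §3 `tameWCC_of_T` — 10809T contains tame-generic weak cosmic censorship (the summit's first
  conjunct in its re-typed form), by monotonicity of tame genericity: the tame kernel exists.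
* §4 `closes_stale` — documentation only: the route's `closes` (rev 2) maps OLD genericity by
  `IsChristodoulouGeneric`-monotonicity and therefore no longer elaborates against the re-typed
  Statement (scratch/Probe4.lean: `Type mismatch … IsChristodoulouGeneric … expected
  IsTameChristodoulouGeneric`); the farm currently serves a stale olean for the route module.
-/

noncomputable section

set_option linter.dupNamespace false
set_option linter.unusedSectionVars false

open Set Filter
open scoped Manifold ContDiff Topology ENNReal

namespace Summit.FinalStateConjecture.FinalStateConjecture.Cruxes.GenericCensorshipCollarMargin.Round2K5

open Literature.Geometry.Lorentzian

/-! ## §1 Core persistence (first lemma of the no-go; stated, not proved here) -/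

/-- **Core persistence, pointwise germ.** For every jointly smooth one-parameter family of initial
data sets, the components of `(h_c, k_c)` at every point converge to those of the base datum as
`c → 0`.  (The `C^N`-on-compacta version follows the same way from joint smoothness; this is the
`N = 0`, pointwise case.)  Consequence used in `ROUND2-k5.md` §2: through a datum `d` whose
development has an uncontrolled black-hole interior, EVERY admissible witness family — burial,
far tails, anything — has members `F c`, `0 < |c| < ε`, whose developments contain (a Cauchy-stable
copy of) that interior, so a margin clause that reads whole MGHDs is undecidable along the family
exactly where it is undecidable for `d`. -/
def CorePersistence : Prop :=
  ∀ (X : Type) [TopologicalSpace X] [ChartedSpace E3 X]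
    [IsManifold (𝓡 3) ((⊤ : ℕ∞) : WithTop ℕ∞) X]
    (F : EuclideanSpace ℝ (Fin 1) → InitialDataSet (𝓡 3) X),
    InitialDataSet.IsSmoothDataFamily 1 F →
      ∀ (x : X) (u w : TangentSpace (𝓡 3) x),
        Tendsto (fun c => (F c).h.inner x u w) (𝓝 0) (𝓝 ((F 0).h.inner x u w)) ∧
        Tendsto (fun c => (F c).k x u w) (𝓝 0) (𝓝 ((F 0).k x u w))

/-! ## §2 The candidate tame restatement 10809T -/

/-- Boost size of a motion (verbatim `RestatementProbeC3.boostNorm`). -/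
abbrev boostNorm (mo : lorentzGroup × E4) : ℝ :=
  max ‖((mo.1 : E4 ≃L[ℝ] E4) : E4 →L[ℝ] E4)‖ ‖((mo.1 : E4 ≃L[ℝ] E4).symm : E4 →L[ℝ] E4)‖

variable {X : Type} [TopologicalSpace X] [ChartedSpace E3 X]
  [IsManifold (𝓡 3) ((⊤ : ℕ∞) : WithTop ℕ∞) X] [T2Space X] [SecondCountableTopology X]
  [ConnectedSpace X]

/-- **Windowed, order-2, future, visible collar margin of ONE development** (the margin conjunct of
10809T).  For every label window `[m₀, m₀⁻¹]` and boost bound `ρ₀` there are `χ₁ < 1`, `δ₁ > 0`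
and a compact `K₁` such that every thick collar chart with windowed label and bounded boost which
is `δ₁`-quiet IN `C²` on its slab, whose slab lies in `J⁺(ι X)` (H4), meets the visible region
`I⁻(𝓘⁺) ∩ M` (H5a) and avoids `J⁻(K₁)`, has `|a₁| ≤ χ₁ M₁`.  Order 2 is forced by the
Dafermos–Rodnianski `o₂` class (VERDICT-c3 §3); the label window kills extremal-label junk at
`M₁ → ∞` (p103863) and micro-collars at `M₁ → 0`; H4/H5a are HYGIENE-c2's. -/
def MarginClauseT {D : InitialDataSet (𝓡 3) X} (𝒟 : VacuumCauchyDevelopment D) : Prop :=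
  ∀ [𝒟.metric.HasLeviCivita], ∀ m₀ ρ₀ : ℝ, 0 < m₀ → 0 < ρ₀ →
    ∃ (χ₁ : ℝ) (δ₁ : ENNReal) (K₁ : Set 𝒟.carrier), χ₁ < 1 ∧ 0 < δ₁ ∧ IsCompact K₁ ∧
      ∀ (M₁ a₁ : ℝ) (mo₁ : lorentzGroup × E4) (B₁ : ModelBackground)
        (Φ₁ : B₁.domain → 𝒟.carrier),
        m₀ ≤ M₁ → M₁ ≤ m₀⁻¹ → boostNorm mo₁ ≤ ρ₀ → |a₁| ≤ M₁ →
        B₁ = starBackground mo₁.1 mo₁.2 M₁ a₁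
          (fun x => Kerr.radius a₁ (poincareInv mo₁.1 mo₁.2 x)) →
        ContMDiffOn 𝓘(ℝ, E4) (𝓡 4) ((⊤ : ℕ∞) : WithTop ℕ∞) Φ₁
          {x | -1 < B₁.time x.1 ∧ B₁.time x.1 < 1 ∧ B₁.radius x.1 < 3 * M₁ + 1} →
        Topology.IsOpenEmbedding
          ({x | -1 < B₁.time x.1 ∧ B₁.time x.1 < 1 ∧
              B₁.radius x.1 < 3 * M₁ + 1}.restrict Φ₁) →
        𝒟.toSpacetime.truncDeviationCk B₁ Φ₁ 2 (3 * M₁) 0 ≤ δ₁ →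
        Φ₁ '' B₁.truncTimeSlab (3 * M₁) 0 ⊆
          𝒟.metric.causalFuture 𝒟.timeOrientation (Set.range 𝒟.embed) →
        (Φ₁ '' B₁.truncTimeSlab (3 * M₁) 0 ∩ 𝒟.toDataEmbedding.visibleRegion).Nonempty →
        Disjoint (Φ₁ '' B₁.truncTimeSlab (3 * M₁) 0)
          (𝒟.metric.causalPast 𝒟.timeOrientation K₁) →
        |a₁| ≤ χ₁ * M₁

/-- **10809T, pointwise body**: every MGHD has complete `𝓘⁺` (sojourn form) and the windowed
order-2 future visible collar margin. -/
def TProperty (X : Type) [TopologicalSpace X] [ChartedSpace E3 X]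
    [IsManifold (𝓡 3) ((⊤ : ℕ∞) : WithTop ℕ∞) X] [T2Space X] [SecondCountableTopology X]
    [ConnectedSpace X] (D : InitialDataSet (𝓡 3) X) : Prop :=
  ∀ 𝒟 : VacuumCauchyDevelopment D, 𝒟.IsMaximal →
    Summit.FinalStateConjecture.HasCompleteNullInfinity 𝒟.toCauchyDevelopment ∧ MarginClauseT 𝒟

/-- **10809T — candidate TAME restatement of the crux** (the genericity notion of the re-typed
summit: one fixed end, continuous mass, weighted `C²₋₁ × C¹₋₂` continuity at `c = 0`, immersed
at `0`; burial families are illegal, far tails of order ≥ 3 remain legal). -/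
def GenericCensorshipCollarMarginT : Prop :=
  ∀ (X : Type) [TopologicalSpace X] [ChartedSpace E3 X]
    [IsManifold (𝓡 3) ((⊤ : ℕ∞) : WithTop ℕ∞) X] [T2Space X] [SecondCountableTopology X]
    [ConnectedSpace X],
    InitialDataSet.IsTameChristodoulouGeneric (admissibleVacuumData X) (TProperty X) 1

/-! ## §3 10809T contains tame-generic weak cosmic censorship -/

/-- Tame-generic weak cosmic censorship in the summit's typing (the first conjunct of the re-typed
`FinalStateConjecture`, without the anti-vacuity conjunct). -/
def TameWCC : Prop :=
  ∀ (X : Type) [TopologicalSpace X] [ChartedSpace E3 X]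
    [IsManifold (𝓡 3) ((⊤ : ℕ∞) : WithTop ℕ∞) X] [T2Space X] [SecondCountableTopology X]
    [ConnectedSpace X],
    InitialDataSet.IsTameChristodoulouGeneric (admissibleVacuumData X)
      (fun D => ∀ 𝒟 : VacuumCauchyDevelopment D, 𝒟.IsMaximal →
        Summit.FinalStateConjecture.HasCompleteNullInfinity 𝒟.toCauchyDevelopment) 1

/-- **10809T ⇒ tame-generic WCC** (tame genericity is monotone under pointwise implication,
`IsTameChristodoulouGeneric.mono`, re-proved inline since `TameGenericityDiagonal` is unbuilt on the farm): the restated crux still contains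
the summit's first conjunct verbatim — it is an honest open problem, not bookkeeping. -/
theorem isTameChristodoulouGeneric_mono {𝓓 : Set (InitialDataSet (𝓡 3) X)}
    {P Q : InitialDataSet (𝓡 3) X → Prop} {m : ℕ}
    (h : InitialDataSet.IsTameChristodoulouGeneric 𝓓 P m)
    (hPQ : ∀ d ∈ 𝓓, P d → Q d) : InitialDataSet.IsTameChristodoulouGeneric 𝓓 Q m := by
  intro d hd
  obtain ⟨e, F, hF, himm, h0, hinj, hD, hE⟩ := h d ⟨hd.1, fun hP => hd.2 (hPQ d hd.1 hP)⟩
  exact ⟨e, F, hF, himm, h0, hinj, hD,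
    fun c hc hmem => hE c hc ⟨hmem.1, fun hP => hmem.2 (hPQ _ hmem.1 hP)⟩⟩

theorem tameWCC_of_T (h : GenericCensorshipCollarMarginT) : TameWCC := by
  intro X _ _ _ _ _ _
  exact isTameChristodoulouGeneric_mono (h X) fun D _ hP 𝒟 h𝒟 => (hP 𝒟 h𝒟).1

/-- The vacuity direction survives the restatement unchanged: a datum WITHOUT a maximal vacuum
Cauchy development satisfies `TProperty` trivially (content is conditional on `MGHDExists`). -/
theorem tProperty_of_no_mghd {D : InitialDataSet (𝓡 3) X}
    (h : ∀ 𝒟 : VacuumCauchyDevelopment D, ¬ 𝒟.IsMaximal) : TProperty X D :=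
  fun 𝒟 h𝒟 => absurd h𝒟 (h 𝒟)

/-! ## §4 (documentation) the route's `closes` is stale

`Theses/BartnikGapSettling.lean` rev 2, `closes`, l.461–471: `have mono : … IsChristodoulouGeneric … P 1 →
… → IsChristodoulouGeneric … Q 1 := …; refine mono (h₄ X) ?_` — against the Statement re-typed at
2026-08-16T21:18Z this is `Type mismatch: IsChristodoulouGeneric … but is expected to have type
IsTameChristodoulouGeneric …` (re-elaborated verbatim in the ideator's scratch/Probe4.lean, rc 1).
The compiled `closes` that `import`s today is an olean built before the re-type.  Hence 10809 MUST be
re-filed over `IsTameChristodoulouGeneric` (as PhotonSphereChannels' K3″ and HonestFixedRadiusSettling's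
G′ were), and `Capture` (stmt-10115) must also deliver the two new Statement conjuncts
`RaysStayInClosure` and `IsFutureOriented`. -/
example : True := trivial

end Summit.FinalStateConjecture.FinalStateConjecture.Cruxes.GenericCensorshipCollarMargin.Round2K5

end
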